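import Summits.BirchSwinnertonDyer.Rank1Residual.ManinAdditive.CMTwinStevensMinimalMembersCor
import HarnessLib

/-!
# CM root `Γ₁(N)`-law at the prime `3` on the CM fields in which `3` SPLITS — THEOREM 45 transferred to
# `K ∈ {ℚ(√−2), ℚ(√−11)}` at `𝔭 𝔭̄ = (3)` (cell `bsd-f2-manin`, planner `es` g32, MEMO-es §49; FILE A⁗ = this file,
# lands after `…CMTwinStevensMinimalMembersCor`, independent of `CMGammaOneRootLawBeyondQi` / `…InertThree`; T-es-54)

TYPER NOTE (typer g20, T-es-54).  SOURCE = HOME/es/g32/SplitThree-es-g32.lean sha16 8a21cfd40d38125e (95 l.; es: farm rc 0 · 0 err · 0 warn · 0 s∗rry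
DIRECT at 16:46Z; typer: own farm check rc 0 · 0 warnings) VERBATIM except this note.  Continues ns `…ManinAdditive.KatoCurve.CMTwinMinimal` (FILE A =
`CMTwinStevensMinimalMembers` p729412 + `…Cor` p729422; siblings A′ `CMGammaOneRootLawBeyondQi` p732179, A‴ `CMGammaOneRootLawInertThree` p732653 —
independent).  `@[conjecture]` (es's own tag) on the cell row **E-es-158 `CMGammaOneRootLawThreeLocalJSplit`** (root Γ₁(N)-law, 3-local, on the curves
with CM by ℤ[√−2] (j = 8000) or ℤ[(1+√−11)/2] (j = −32768), 9 ∣ N) — es files it as THEOREM 48 (λ) := THEOREM 45 at a SPLIT prime of norm 3, PAPER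
and CONDITIONAL on the STEP-4 transfer to the ordinary place (audit R-es-75 PENDING at landing time) ⇒ obligation node.  PROVED here (es): COR 49.S
`not_three_dvd_maninConstant₁_on_cmCurve_split_of_rootLawAtThree` (Stevens' 3 ∤ c₁ at the X₁(N)-optimal curve) and COR 49.R
`not_three_dvd_maninConstant_on_cmCurve_split_of_rootLawAtThree` (C3's 3 ∤ c₀), law applied at the optimal curve itself.  With E-es-152₃ / 156 / 157
this completes the typed CM locus of C3's domain over the nine class-number-one fields (es MEMO-es §49).  BC5 (es): census 10 + 10 classes N < 5·10⁵
(CENSUS-P3-v1); witnesses ENGINEA-G1-v1 (965 nonzero Γ₁(N)-periods on 6 classes, all 3-integral), ENGINEC-H-v1; data ask D-es-g32-3 open.  Typer checks: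
decl names fresh in the tree; no `[cite:]` keys; imports `…CMTwinStevensMinimalMembersCor` + HarnessLib only (route-independent); no instances, no
notation.  PARTITION 0 · beyond-print theorem: no (paper candidate, conditional) · bears_on stmt-BirchSwinnertonDyer-22968 (C3) · BSD is not proved by
this; E-es-158, C3 OPEN.

Contents: one conjecture node (E-es-158 `CMGammaOneRootLawThreeLocalJSplit`) and COR 49: Stevens' `3 ∤ c₁` and C3's
`3 ∤ c₀` on every elliptic curve over `ℚ` with CM by `ℤ[√−2]` (`j = 8000`) or by `ℤ[(1+√−11)/2]` (`j = −32768`) and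
`9 ∣ N` (law applied at the optimal curve itself; every member of such a class has the same `j`, the orders of
conductor `> 1` in these two fields having class number `> 1`).  With E-es-152₃ (`ℚ(√−3)`), E-es-156 (`ℚ(i)`), E-es-157
(the five other inert fields) this makes the typed CM locus of C3's domain (`9 ∣ N`) COMPLETE over the nine
class-number-one fields (`ℚ(√−3)`: all levels; the other eight: `9 ∥ N` forced).
Status of the law: THEOREM 48 (λ) := THEOREM 45 (MEMO-es §45, REF1 §R163) at a SPLIT prime of norm `3` — PAPER,
CONDITIONAL on the STEP-4 transfer to the ordinary place (the `𝔭`-power torsion is contained in the formal group at every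
`𝔓 ∣ 𝔭`, a Lubin–Tate `O_𝔭 = ℤ₃`-module of height one; audit ask R-es-75); kernel status: conjecture node.
Witnesses (MEMO-es §49): engine A (`Γ₁(N)`-periods, 6 classes, 965 nonzero periods, all `3`-integral at both primes above
`3`) and engine C at `𝔭` and at `𝔭̄` (class formula validated against engine A to `10⁻¹³`; `v_𝔭(G(1)) ≥ 1 = j_k` attained;
`v(D/Ω′) ≥ 0` sharp).  PARTITION 0 · beyond-print theorem: no · bears_on stmt-BirchSwinnertonDyer-22968 (C3) ·
BSD is not proved by this.
-/

set_option autoImplicit false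

noncomputable section

namespace Summit.BirchSwinnertonDyer.Rank1Residual.ManinAdditive.KatoCurve.CMTwinMinimal

open Complex Polynomial WeierstrassCurve Literature.NumberTheory.EllipticCurves
  Literature.NumberTheory.EllipticCurves.ModularForms
  Summit.BirchSwinnertonDyer.Rank1Residual.ManinAdditive.KatoCurve.CMOptimal
  Summit.BirchSwinnertonDyer.Rank1Residual.ManinAdditive.KatoCurve.CMOptimal.TwinLattice

/-! ## §9 The prime `3` on the CM fields in which `3` SPLITS: `ℚ(√−2)` (`j = 8000`) and `ℚ(√−11)` (`j = −32768`)
(MEMO-es §49)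

THEOREM 48 (λ) (paper, conditional on the STEP-4 transfer): `(3) = 𝔭 𝔭̄` in `K`, `N𝔭 = 3`; `k = f(ε_𝔭) ≤ 1`
(`U₁ = 1 + 𝔭O_𝔭 ≅ 1 + 3ℤ₃` pro-`3`, `ε` `±1`-valued) and `k_𝔭 = k_𝔭̄` (`𝔣̄ = 𝔣`), so `v₃(N) ∈ {0, 2}`; for `9 ∥ N`:
`(O/𝔭)^× / {±1} = 1`, `R₁ = K`, `(h, d, e) = (1, 0, 1)`, `ker₁ = 1`, `τ = v(t_β) = 1/(N𝔭 − 1) = 1/2`,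
`ν = v₃(Δ_min)/12 = 1/2` (twists by `3` of `3`-good curves); STEP 4: `v_𝔭(G(1)) > ν` ⟹ `v_𝔭(G(1)) ≥ 1 = k`, and the
same at `𝔭̄`; STEP 5 is empty (`h = 1`); `D/Ω′ = ± conj(T3_V/μ)/2` ⟹ `v_𝔭, v_𝔭̄ (D/Ω′) ≥ 0`: the ROOT law, `δ = 0`. -/

section SplitThree

open CongruenceSubgroup
open scoped MatrixGroups ModularForm

variable {N : ℕ} [NeZero N]

/-- **E-es-158 — root `Γ₁(N)`-law on the split-CM slice, `3`-local** (THEOREM 48 (λ): `K = ℚ(√−2)` (`j = 8000`) or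
`K = ℚ(√−11)` (`j = −32768`), `(3) = 𝔭 𝔭̄` split, `k = 1` at both, `R₁ = K`, `(h, d) = (1, 0)`, `ν = 1/2`, `δ = 0`):
for every globally minimal `V` with `j(V) ∈ {8000, −32768}` and `9 ∣ N`, every newform `f` of its class and its Néron
lattice `L`, `Λ₁(f) ⊆ L ⊗ ℤ₍₃₎`.
Why it might fail: the place is ORDINARY — THEOREM 45's STEP 4 was audited (REF1 §R163) only at supersingular places;
the transfer rests on `E[𝔭^∞] ⊆ Ê` at `𝔓 ∣ 𝔭` (height-one Lubin–Tate `O_𝔭`-module), unaudited (R-es-75).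
[B] es g32 MEMO-es §49; census 10 + 10 classes `N < 5·10⁵` (CENSUS-P3-v1); witnesses ENGINEA-G1-v1 (965 nonzero
`Γ₁(N)`-periods on 6 classes, all `3`-integral), ENGINEC-H-v1 (engine C at `𝔭` and `𝔭̄`, class formula = engine A to `10⁻¹³`). -/
@[conjecture]
def CMGammaOneRootLawThreeLocalJSplit : Prop :=
  ∀ (V : WeierstrassCurve ℚ) [V.IsElliptic] [V.IsGloballyMinimal] {N : ℕ} [NeZero N]
    (f : CuspForm (Gamma0 N) 2) (L : PeriodPair),
    (V.j = 8000 ∨ V.j = -32768) → 3 ^ 2 ∣ N → IsNewformOf V f → IsNeronLatticeOf (V.baseChange ℂ) L →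
    ∀ z ∈ periodLatticeGamma1 f, ∃ s : ℤ, ¬ (3 : ℤ) ∣ s ∧ (s : ℂ) * z ∈ L.lattice

/-- **COR 49.S — Stevens at `3` on the split-CM slice**: the `X₁(N)`-optimal curve `W` with `j(W) ∈ {8000, −32768}`
and `9 ∣ N` has `3 ∤ c₁` (law applied at `W` itself). -/
theorem not_three_dvd_maninConstant₁_on_cmCurve_split_of_rootLawAtThree (h : CMGammaOneRootLawThreeLocalJSplit)
    (W : WeierstrassCurve ℚ) [W.IsElliptic] [W.IsGloballyMinimal] (D : Gamma1ParametrizationData W N)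
    (hopt : D.IsOptimal) (hj : W.j = 8000 ∨ W.j = -32768) (hN : 3 ^ 2 ∣ N) : ¬ (3 : ℤ) ∣ D.maninConstant :=
  not_dvd_maninConstant₁_of_rootLaw_of_witness D hopt (h W D.f D.L hj hN D.isNewformOf D.isNeronLattice)
    (exists_primitive_witness D.L 3)

/-- **COR 49.R — C3 for `X₀(N)`-data on the split-CM slice** with a second traceless prime `q ≠ 3`, `q² ∣ N`
(always available: `q = 2` for `j = 8000` (`2⁸ ∣ N`), `q = 11` for `j = −32768` (`11² ∣ N`)). -/
theorem not_three_dvd_maninConstant_on_cmCurve_split_of_rootLawAtThree (h : CMGammaOneRootLawThreeLocalJSplit)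
    (W : WeierstrassCurve ℚ) [W.IsElliptic] [W.IsGloballyMinimal] (D : ModularParametrizationData W N)
    (hD : ∀ z ∈ D.L.lattice, ∃ w ∈ periodLattice D.f, z = D.c * w)
    (hj : W.j = 8000 ∨ W.j = -32768) {q : ℕ} (hq : q.Prime) (hq3 : q ≠ 3) (hN : 3 ^ 2 ∣ N) (hqN : q ^ 2 ∣ N) :
    ¬ (3 : ℤ) ∣ D.maninConstant := by
  have hfW : IsNewformOf W D.f := D.isNewformOf
  have heq := ModularForms.gamma1LatticeEqOfTwoTracelessPrimes_holds N D.f hfW.1 3 q Nat.prime_three hq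
    (Ne.symm hq3) ((dvd_pow_self 3 two_ne_zero).trans hN) ((dvd_pow_self q two_ne_zero).trans hqN)
    (hfW.1.cuspCoeff_eq_zero_of_sq_dvd Nat.prime_three hN) (hfW.1.cuspCoeff_eq_zero_of_sq_dvd hq hqN)
  obtain ⟨z, hz, hzM⟩ := exists_primitive_witness D.L 3
  refine not_dvd_maninConstant_of_saturated_mem_of_witness D hD Int.prime_three D.L.lattice
    (fun γ => h W D.f D.L hj hN hfW D.isNeronLattice _ ?_) ⟨z, hz, fun s hs m hm => ?_⟩
  · rw [heq]; unfold periodLattice; exact AddSubgroup.subset_closure ⟨γ, rfl⟩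
  · exact_mod_cast hzM s hs m hm

end SplitThree

end Summit.BirchSwinnertonDyer.Rank1Residual.ManinAdditive.KatoCurve.CMTwinMinimal

end
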